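import Literature.AlgebraicGeometry.Frobenioids.ArithmeticRealificationCoordinates
import HarnessLib

/-!
# Frobenioids I, Cor. 5.4 at `C_{K/F}` (row C54-core-arith, sub-row (4), input (D1)): integral and
# fractional parts in THE realification `(Φ(L)^rlf)^gp` of the arithmetic divisor monoid

Mochizuki, *The geometry of Frobenioids I: the general theory*, Kyushu J. Math. **62** (2008) 293–400,
Cor. 5.4 p. 104 (1-uniqueness / rigidity of `Ψ^rlf : C₁^rlf → C₂^rlf`), at THE realification (Prop. 5.3
p. 103) of the arithmetic Frobenioid `C_{K/F}` of Ex. 6.3 / Thm. 6.4 (i) p. 115 ("`(Φ^rlf)^gp(L) = ArithDiv_ℝ(L)`";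
Def. 2.4 (i) p. 48: `M^rlf` is an `ℝ_{≥0}`-semimodule, `(M^rlf)^gp` an `ℝ`-vector space).
[cite: MochizukiFrdI2008, Cor. 5.4 p.104] [cite: MochizukiFrdI2008, Thm. 6.4 (i) p.115] [cite: MochizukiFrdI2008, Def. 2.4(i) p.48]

PROOF-ONLY (cell abc-iut, seat abc-iut-L1-d2; input «(D1) small linear morphisms» of the final data-level
file of sub-row (4), L1-lead R124 (1); consumers: the assembly `Cor54RigidityArithMorphisms` and the
per-place splittings of `Cor54RigidityArith*`).  For a number field `L`, THE realification `Φ(L)^rlf`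
(`IsPerfFactorial.Rlf`) of `Φ(L) = Multiplicative (EffArithDivisor L)` and `ι : Φ(L) → Φ(L)^pf → Φ(L)^rlf`
(`hM.toRealification ∘ Perfection.of`), this file PROVES the **integral/fractional-part decomposition**:

* **`ArithRlfCoord.exists_fractionalPart`** — for every `ξ ∈ (Φ(L)^rlf)^gp` there is ONE effective divisor
  `S ∈ Φ(L)` (the sum of the prime divisors `[v]` over the finite places `v` in the support of `ξ`) such that
  for EVERY `n ∈ ℤ`:  `ξ^n = ι^gp(g) · [z]` for some `g ∈ Φ(L)^gp` (the "integral part": `⌊n·ξ_v⌋` at finite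
  `v`, all of `n·ξ_w` at archimedean `w`, where `Φ(L)` has real coordinates) and some `z ∈ Φ(L)^rlf` (the
  "fractional part" `∏_v [v]^{fract(n·ξ_v)}`, an `ℝ_{≥0}`-power product, Def. 2.4 (i)) with `z ∣ ι(S)` — stated
  as `[z] = ι^gp(g') · ξ^n ∧ z ∣ ι(S)` (`g' = g⁻¹`);
* `ArithRlfCoord.exists_fractionalPart_one` — the case `n = 1`;
* `ArithRlfCoord.exists_fractionalPart_of_eq` — the same for any arrow `ι'` agreeing with `ι` pointwise
  (the component of THE realification data's `Φ → Φ^rlf` is such an `ι'`, by `rfl` pointwise).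

So every class of `(Φ(L)^rlf)^gp` (in particular every element of the rational function monoid
`ℝ·Φ^birat(L) ⊆ (Φ(L)^rlf)^gp` of Prop. 5.3) differs from an effective element BOUNDED BY `ι(S)` by an element
of `ι^gp(Φ(L)^gp)`, uniformly in powers — the "small identity-base linear morphisms" between `untrToRlf`-image
objects used in the rigidity argument of Cor. 5.4 at `C_{K/F}` ("by a similar argument applied to prove the
rigidity assertion in Corollary 4.11, (i), (iv)", p. 104 l. 22–24).  Proof: in seat abc-iut-L1-d2's coordinates
`Θ : (Φ(L)^rlf)^gp ↪ ADiv_ℝ(L)` (`exists_rlfGp_coordinates`: injective, `ι`-compatible, `ℝ`-linear) both sides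
have the same coefficients (`⌊a⌋ + fract(a) = a`); `[v]^r · [v]^{1-r} = [v]`.  Nothing here is specific to the
abc programme; no side taken on [IUTchIII] Cor. 3.12.
-/

noncomputable section

open scoped NNReal

namespace Literature.AlgebraicGeometry.Frobenioids

namespace ArithRlfCoord

open Function NumberField IsDedekindDomain Literature.IUT.LogVolume

variable {L : Type} [Field L] [NumberField L]

/-! ### Coordinates of `ℝ_{≥0}`-powers and of the prime divisors -/

section Coordinates

variable {hM : IsPerfFactorial (Multiplicative (EffArithDivisor L))}
  (Θ : Algebra.GrothendieckGroup hM.Rlf →* Multiplicative (ADivisor L))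
  (hι : ∀ D : EffArithDivisor L,
    Θ (Algebra.GrothendieckGroup.of (hM.toRealification (Perfection.of _ (Multiplicative.ofAdd D)))) =
      Multiplicative.ofAdd (ADivisor.ofArithDivisor L (EffArithDivisor.toArithDivisor L D)))
  (hlin : ∀ (r : ℝ) (ξ : Algebra.GrothendieckGroup hM.Rlf),
    Θ (IsPerfFactorial.Rlf.realSMul hM r ξ) = Multiplicative.ofAdd (r • Multiplicative.toAdd (Θ ξ)))

include hlin in
/-- In coordinates, `[a^r] = r · [a]` for `r ≥ 0` (`ℝ`-linearity of `Θ` on the `ℝ_{≥0}`-powers of Def. 2.4 (i)).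
[cite: MochizukiFrdI2008, Def. 2.4(i) p.48] -/
theorem toAdd_coord_of_rpow (r : ℝ≥0) (x : hM.Rlf) :
    Multiplicative.toAdd (Θ (Algebra.GrothendieckGroup.of (IsPerfFactorial.Rlf.rpow hM r x))) =
      (r : ℝ) • Multiplicative.toAdd (Θ (Algebra.GrothendieckGroup.of x)) := by
  rw [← IsPerfFactorial.Rlf.realSMul_coe_of, hlin, toAdd_ofAdd]

/-- `FinitePlace.mk` is injective (finite places ↔ height-one primes). [folklore] -/
private theorem finitePlace_mk_injective :
    Injective (FinitePlace.mk : HeightOneSpectrum (𝓞 L) → FinitePlace L) := fun a b h => by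
  have h' := congrArg FinitePlace.maximalIdeal h
  rwa [FinitePlace.maximalIdeal_mk, FinitePlace.maximalIdeal_mk] at h'

include hι in
/-- In coordinates, `ι[v]` for the prime divisor `[v] = (single v 1, 0) ∈ Φ(L)` at a finite place `v` is the
characteristic function `single v 1 ∈ ADiv_ℝ(L)`. [cite: MochizukiFrdI2008, Thm. 6.4 (i) p.115] -/
theorem toAdd_coord_iota_prime (v : HeightOneSpectrum (𝓞 L)) :
    Multiplicative.toAdd (Θ (Algebra.GrothendieckGroup.of (hM.toRealification (Perfection.of _
      (Multiplicative.ofAdd ((Finsupp.single (FinitePlace.mk v) 1, 0) : EffArithDivisor L)))))) =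
      Finsupp.single (Sum.inr v) 1 := by
  classical
  rw [hι, toAdd_ofAdd]
  refine Finsupp.ext fun p => ?_
  rcases p with w | v'
  · rw [ADivisor.ofArithDivisor_apply_inl, EffArithDivisor.toArithDivisor_snd,
      Finsupp.single_eq_of_ne Sum.inl_ne_inr]
    dsimp only
    rw [Pi.zero_apply, NNReal.coe_zero, mul_zero]
  · rw [ADivisor.ofArithDivisor_apply_inr, EffArithDivisor.toArithDivisor_fst]
    dsimp only
    by_cases h : v' = v
    · subst h
      rw [Finsupp.single_eq_same, Finsupp.single_eq_same, Nat.cast_one, Int.cast_one]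
    · rw [Finsupp.single_eq_of_ne (fun h' => h (finitePlace_mk_injective h')),
        Finsupp.single_eq_of_ne (fun h' => h (Sum.inr_injective h')), Nat.cast_zero, Int.cast_zero]

end Coordinates

/-! ### The integral/fractional-part decomposition -/

variable (hM : IsPerfFactorial (Multiplicative (EffArithDivisor L)))

/-- **Integral and fractional parts in `(Φ(L)^rlf)^gp`, uniformly in powers.**  For every
`ξ ∈ (Φ(L)^rlf)^gp` there is an effective divisor `S ∈ Φ(L)` (the reduced divisor of the finite places in the
support of `ξ`) such that for every `n ∈ ℤ` there are `z ∈ Φ(L)^rlf` with `z ∣ ι(S)` (the fractional part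
`∏_v [v]^{fract(n ξ_v)}`) and `g ∈ Φ(L)^gp` (minus the integral part) with `[z] = ι^gp(g) · ξ^n`.  Here
`ι = (Φ(L) → Φ(L)^pf → Φ(L)^rlf)` and `ι^gp = MonGp.map ι`.  (The `ℝ_{≥0}`-semimodule `Φ^rlf ⊇ ι(Φ)` of
Def. 2.4 (i) read through `(Φ^rlf)^gp(L) = ArithDiv_ℝ(L)`, Thm. 6.4 (i); used for the rigidity clause of
Cor. 5.4 at `C_{K/F}`.) [cite: MochizukiFrdI2008, Cor. 5.4 p.104] [cite: MochizukiFrdI2008, Thm. 6.4 (i) p.115] -/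
theorem exists_fractionalPart (ξ : Algebra.GrothendieckGroup hM.Rlf) :
    ∃ S : Multiplicative (EffArithDivisor L), ∀ n : ℤ,
      ∃ (z : hM.Rlf) (g : Algebra.GrothendieckGroup (Multiplicative (EffArithDivisor L))),
        Algebra.GrothendieckGroup.of z =
            MonGp.map (hM.toRealification.comp (Perfection.of _)) g * ξ ^ n ∧
          z ∣ hM.toRealification (Perfection.of _ S) := by
  classical
  obtain ⟨Θ, hinj, hι, -, hlin⟩ := exists_rlfGp_coordinates hM
  -- `ι : Φ(L) → Φ(L)^rlf`, the prime divisors `[v]` at the finite places, the finite support of `ξ`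
  set ι : Multiplicative (EffArithDivisor L) →* hM.Rlf := hM.toRealification.comp (Perfection.of _)
    with hιdef
  let P : HeightOneSpectrum (𝓞 L) → Multiplicative (EffArithDivisor L) := fun v =>
    Multiplicative.ofAdd ((Finsupp.single (FinitePlace.mk v) 1, 0) : EffArithDivisor L)
  have hP : ∀ v : HeightOneSpectrum (𝓞 L),
      Multiplicative.toAdd (Θ (Algebra.GrothendieckGroup.of (ι (P v)))) = Finsupp.single (Sum.inr v) 1 :=
    fun v => toAdd_coord_iota_prime Θ hι v
  let c : ADivisor L := Multiplicative.toAdd (Θ ξ)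
  let Sfin : Finset (HeightOneSpectrum (𝓞 L)) := c.support.preimage Sum.inr Sum.inr_injective.injOn
  have hSfin : ∀ v, v ∉ Sfin → c (Sum.inr v) = 0 := fun v hv => by
    rw [Finset.mem_preimage, Finsupp.mem_support_iff, not_not] at hv
    exact hv
  refine ⟨∏ v ∈ Sfin, P v, fun n => ?_⟩
  -- the coordinates `a = n · ξ` of `ξ^n`
  let a : ADivisor L := Multiplicative.toAdd (Θ (ξ ^ n))
  have ha : ∀ p, a p = n * c p := fun p => by
    show Multiplicative.toAdd (Θ (ξ ^ n)) p = n * Multiplicative.toAdd (Θ ξ) p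
    rw [map_zpow, toAdd_zpow, Finsupp.smul_apply, zsmul_eq_mul]
  have ha0 : ∀ v, v ∉ Sfin → a (Sum.inr v) = 0 := fun v hv => by rw [ha, hSfin v hv, mul_zero]
  -- fractional parts `r_v ∈ [0, 1)` and the fractional-part element `z = ∏_v [v]^{r_v}`
  let r : HeightOneSpectrum (𝓞 L) → ℝ := fun v => Int.fract (a (Sum.inr v))
  have hr0 : ∀ v, 0 ≤ r v := fun v => Int.fract_nonneg _
  have hr1 : ∀ v, r v ≤ 1 := fun v => (Int.fract_lt_one _).le
  let z : hM.Rlf := ∏ v ∈ Sfin, IsPerfFactorial.Rlf.rpow hM (r v).toNNReal (ι (P v))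
  let e : hM.Rlf := ∏ v ∈ Sfin, IsPerfFactorial.Rlf.rpow hM (1 - r v).toNNReal (ι (P v))
  -- the integral part `(⌊a_v⌋)_v` (finite), `(a_w)_w` (archimedean), as an arithmetic divisor
  let dfin : FinitePlace L →₀ ℤ := Finsupp.onFinset (Sfin.image FinitePlace.mk)
    (fun w => ⌊a (Sum.inr w.maximalIdeal)⌋) (by
      intro w hw
      rw [Finset.mem_image]
      refine ⟨w.maximalIdeal, ?_, FinitePlace.mk_maximalIdeal w⟩
      by_contra hmem
      exact hw (by rw [ha0 _ hmem, Int.floor_zero]))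
  have hdfin : ∀ v : HeightOneSpectrum (𝓞 L), dfin (FinitePlace.mk v) = ⌊a (Sum.inr v)⌋ := fun v => by
    rw [Finsupp.onFinset_apply, FinitePlace.maximalIdeal_mk]
  let dinf : InfinitePlace L → ℝ := fun w => a (Sum.inl w) / w.mult
  obtain ⟨D, E, hDE⟩ := ArithDivisor.exists_sub_eq L (dfin, dinf)
  refine ⟨z, Algebra.GrothendieckGroup.of (Multiplicative.ofAdd E) /
      Algebra.GrothendieckGroup.of (Multiplicative.ofAdd D), ?_, ⟨e, ?_⟩⟩
  · /- the identity `[z] = ι^gp(E - D) · ξ^n`, checked coefficientwise in the coordinates `Θ`: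
       at a finite `v`: `fract(a_v) = -⌊a_v⌋ + a_v`; at an archimedean `w`: `0 = -a_w + a_w` -/
    apply hinj
    apply Multiplicative.toAdd.injective
    -- left-hand side
    have hz : Multiplicative.toAdd (Θ (Algebra.GrothendieckGroup.of z)) =
        ∑ v ∈ Sfin, Finsupp.single (Sum.inr v : Place L) (r v) := by
      show Multiplicative.toAdd ((Θ.comp Algebra.GrothendieckGroup.of) (∏ v ∈ Sfin, _)) = _
      rw [map_prod, toAdd_prod]
      refine Finset.sum_congr rfl fun v _ => ?_
      rw [MonoidHom.comp_apply, toAdd_coord_of_rpow Θ hlin, Real.coe_toNNReal _ (hr0 v), hP,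
        Finsupp.smul_single_one]
    -- right-hand side: the integral part
    have hg : Multiplicative.toAdd (Θ (MonGp.map ι (Algebra.GrothendieckGroup.of (Multiplicative.ofAdd E) /
        Algebra.GrothendieckGroup.of (Multiplicative.ofAdd D)))) =
        -ADivisor.ofArithDivisor L (dfin, dinf) := by
      rw [map_div, MonGp.map_of, MonGp.map_of, map_div, toAdd_div, hιdef, MonoidHom.comp_apply,
        MonoidHom.comp_apply, hι, hι, toAdd_ofAdd, toAdd_ofAdd, ← map_sub, ← neg_sub, hDE, map_neg]
    rw [map_mul, toAdd_mul, hz, hg]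
    refine Finsupp.ext fun p => ?_
    rw [Finsupp.finsetSum_apply, Finsupp.add_apply, Finsupp.neg_apply]
    rcases p with w | v'
    · -- archimedean coordinate
      rw [Finset.sum_eq_zero (fun v _ => Finsupp.single_eq_of_ne Sum.inl_ne_inr),
        ADivisor.ofArithDivisor_apply_inl]
      show (0 : ℝ) = -((w.mult : ℝ) * (a (Sum.inl w) / w.mult)) + a (Sum.inl w)
      rw [mul_div_cancel₀ _ InfinitePlace.mult_coe_ne_zero, neg_add_cancel]
    · -- finite coordinate
      have hsum : (∑ v ∈ Sfin, Finsupp.single (Sum.inr v : Place L) (r v) (Sum.inr v')) = r v' := by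
        have h1 : ∀ v ∈ Sfin, Finsupp.single (Sum.inr v : Place L) (r v) (Sum.inr v') =
            if v' = v then r v' else 0 := fun v _ => by
          by_cases h : v' = v
          · subst h
            rw [Finsupp.single_eq_same, if_pos rfl]
          · rw [Finsupp.single_eq_of_ne (fun h' => h (Sum.inr_injective h')), if_neg h]
        rw [Finset.sum_congr rfl h1, Finset.sum_ite_eq]
        by_cases hmem : v' ∈ Sfin
        · rw [if_pos hmem]
        · rw [if_neg hmem]
          show (0 : ℝ) = Int.fract (a (Sum.inr v'))
          rw [ha0 _ hmem, Int.fract_zero]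
      rw [hsum, ADivisor.ofArithDivisor_apply_inr]
      show Int.fract (a (Sum.inr v')) = -((dfin (FinitePlace.mk v') : ℤ) : ℝ) + a (Sum.inr v')
      rw [hdfin, neg_add_eq_sub, Int.self_sub_floor]
  · /- `z · e = ι(S)`: `[v]^{r_v} · [v]^{1 - r_v} = [v]` -/
    show ι (∏ v ∈ Sfin, P v) = z * e
    rw [map_prod, ← Finset.prod_mul_distrib]
    refine Finset.prod_congr rfl fun v _ => ?_
    rw [← IsPerfFactorial.Rlf.rpow_add, ← Real.toNNReal_add (hr0 v) (by linarith [hr1 v]),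
      add_sub_cancel, Real.toNNReal_one, IsPerfFactorial.Rlf.rpow_one]

/-- **The case `n = 1`**: every `ξ ∈ (Φ(L)^rlf)^gp` is `ι^gp(g)⁻¹ · [z]` with `z ∈ Φ(L)^rlf` dividing `ι(S)`,
`S` the reduced divisor of the finite support of `ξ`. [cite: MochizukiFrdI2008, Cor. 5.4 p.104] -/
theorem exists_fractionalPart_one (ξ : Algebra.GrothendieckGroup hM.Rlf) :
    ∃ (S : Multiplicative (EffArithDivisor L)) (z : hM.Rlf)
      (g : Algebra.GrothendieckGroup (Multiplicative (EffArithDivisor L))),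
        Algebra.GrothendieckGroup.of z = MonGp.map (hM.toRealification.comp (Perfection.of _)) g * ξ ∧
          z ∣ hM.toRealification (Perfection.of _ S) := by
  obtain ⟨S, hS⟩ := exists_fractionalPart hM ξ
  obtain ⟨z, g, h, hz⟩ := hS 1
  exact ⟨S, z, g, by rwa [zpow_one] at h, hz⟩

/-- **The same decomposition for any presentation `ι'` of `ι = (Φ(L) → Φ(L)^pf → Φ(L)^rlf)`** (e.g. the
component `(η.app A).hom` of THE realification data's `Φ → Φ^rlf`, which agrees with `ι` pointwise by `rfl`
but not syntactically): consumers instantiate `ι'` with their own arrow. [cite: MochizukiFrdI2008, Cor. 5.4 p.104] -/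
theorem exists_fractionalPart_of_eq (ι' : Multiplicative (EffArithDivisor L) →* hM.Rlf)
    (hι' : ∀ a, ι' a = hM.toRealification (Perfection.of _ a)) (ξ : Algebra.GrothendieckGroup hM.Rlf) :
    ∃ S : Multiplicative (EffArithDivisor L), ∀ n : ℤ,
      ∃ (z : hM.Rlf) (g : Algebra.GrothendieckGroup (Multiplicative (EffArithDivisor L))),
        Algebra.GrothendieckGroup.of z = MonGp.map ι' g * ξ ^ n ∧ z ∣ ι' S := by
  have h : ι' = hM.toRealification.comp (Perfection.of _) := MonoidHom.ext hι'
  rw [h]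
  exact exists_fractionalPart hM ξ

end ArithRlfCoord

end Literature.AlgebraicGeometry.Frobenioids

end
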